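import Summits.QuantumAdvantage.QuantumAdvantage.Theses.CubicForrelation
import Summits.QuantumAdvantage.QuantumAdvantage.Theorems.NearExactIsExact.Negative.XorBound
import Summits.QuantumAdvantage.QuantumAdvantage.Theorems.CubicForrelationExactPairsMaioranaMcFarlandDefectVanishingDillonDual

/-!
# `NearExactIsExact` (stmt-QuantumAdvantage-14043) — negative side: the TWO-SIDED plain-concatenation identity

Disprover seat `b2b-cforr-disprove-g28` (2026-08-22).  HONEST FRAMING: a kernel-checked INSTRUMENT (an identity and
its immediate corollaries) for the search for near-exact non-exact cubic pairs; it is NOT summit progress and does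
not decide the crux `Summit.QuantumAdvantage.QuantumAdvantage.Theses.CubicForrelation.NearExactIsExact`.

Split `N = M + k` bits as `y = (v ‖ a)` on the `g`-side and `x = (u ‖ s)` on the `f`-side (`Fin.append`; the
character factors, `(-1)^{x·y} = (-1)^{u·v} (-1)^{s·a}`).  For ANY Boolean `H, E` on `M + k` bits:

* `ts_W_append` — the Walsh transform of a plain `2^k`-concatenation is the character sum of the slice transforms,
  `W_H(u ‖ s) = Σ_a (-1)^{s·a} W_{H(· ‖ a)}(u)`; hence (`ts_W_of_duals`) if every SLICE `v ↦ H(v ‖ a)` satisfies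
  `W = K_H · (-1)^{D_H(·,a)}` (e.g. is bent, `K_H = √(2^M)`, dual `D_H(·,a)`), then
  `W_H(u ‖ s) = K_H · W_{D_H(u,·)}(s)`: the transform of `H` at `(u ‖ s)` is the transform of the ROW `u` of the
  dual table — `H` is bent iff every row `a ↦ D_H(u,a)` is, whatever the algebraic degree of these rows.
* `ts_fsum_eq` / **`ts_forrelation_eq`** — if moreover every ROW `s ↦ E(u ‖ s)` of the partner satisfies
  `W = K_E · (-1)^{D_E(u,·)}` (bent rows, `K_E = √(2^k)`, duals `D_E(u,·)`), then
  `√(2^{3N}) · Φ(E,H) = K_H K_E · Σ_{u,a} (-1)^{D_H(u,a) ⊕ D_E(u,a)}`, i.e. for bent slices and bent rows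
  **`Φ(E,H) = 1 − 2·#{(u,a) : D_H(u,a) ≠ D_E(u,a)} / 2^{M+k}`**: the forrelation of the pair is the agreement of
  the two DUAL TABLES — the table of duals of the `a`-slices of `H` against the table of duals of the `u`-rows of
  `E` — and `Φ(E,H) = 1` iff the tables coincide (`ts_forrelation_eq_one_iff`).
* `ts_dual_of_tables_eq` — EXACTNESS IS CLASSICAL: if the two tables coincide then `H` is bent with dual `E`
  (Fourier inversion on the rows, `dv_dual_dual`); so the near-exact non-exact pairs of the habitat are those with
  `H` not bent-with-dual-`E`, and (duality being an isometry on bent functions) when `H` IS bent the identity is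
  just the one-block formula `Φ(E,H) = 1 − 2·dist(E,H̃)/2^N` — the new content is the regime where neither `H`
  nor `E` is bent.
* `ts_forrelation_bounds`, `ts_nearExactIsExact_false_of_twoSidedFamilies` — `0 < #{D_H ≠ D_E} ≤ d` gives
  `1 − 2d/2^{M+k} ≤ Φ(E,H) < 1`; hence cubic two-sided families whose relative table distance tends to `0` without
  vanishing would refute the crux (an implication with an OPEN hypothesis, inlined — no new `Prop`).
* `ts_forrelation_swap` — the symmetric special case `M = k`, `E = H ∘ swap`: `Φ(H∘swap, H) = 1 − 2·asym(D_H)/4^k`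
  where `asym` counts the pairs `(u,a)` with `D_H(u,a) ≠ D_H(a,u)`.

Why it matters for the crux (seat file `DISPROOF.md` §36, HOME `run/shared/lean/b2b/cubic-forrelation/`): the
projection concatenation of `ProjectionConcat.lean` (`Φ(pcF C, pcG h) = 2^{-k} Σ_a Φ(C_a,h_a)`) is the special case in
which the partner's rows are Maiorana–McFarland in `(b'', a)` and its dual table is a CUBIC table `C`; there the
defect of a non-exact slice is a cubic distance `≥ 2^{M-3}` and every construction met a degree wall (Ax / Hou /
inversion-affinity).  In the two-sided form neither table is a priori of degree `≤ 3`: the columns of `D_H` are duals of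
`M`-bit bent cubics (degree up to `M/2`), the rows of `D_E` duals of `k`-bit bent cubics (degree up to `k/2`), and
cubicity constrains only `H` and `E` themselves.  A jointly cubic pair with `0 < #{D_H ≠ D_E} = o(2^{M+k})` along
`M + k → ∞` would refute the crux; the identity is the exact evaluator used by the seat's census of the
"bi-Maiorana–McFarland" sub-family (kit job j158585, which also re-verifies the identity numerically on 320 random
instances at `N = 8, 10, 12, 14`).  Proved from the tree (`sum_append`, `twist_append`, `fsum_eq_sum_mul_W(')`,
`fsum_signOf_eq`, `cd_sum_signOf_mul_signOf`, `xb_exists_order`, `dv_dual_dual`); standard axioms only.  References: C. Carlet, *Boolean Functions for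
Cryptography and Coding Theory* (CUP 2021) §6.1 (concatenation of bent functions and their duals); S. Aaronson,
A. Ambainis, *Forrelation*, SIAM J. Comput. 47 (2018) §1.1.1. [folklore]
-/

set_option linter.dupNamespace false -- D-0017: single-problem summit ⇒ `QuantumAdvantage.QuantumAdvantage` by design

noncomputable section

namespace Summit.QuantumAdvantage.QuantumAdvantage.Theorems.NearExactIsExact.Negative.TwoSidedConcat

open Finset
open Literature.Computability.QuantumComplexity
open Literature.Computability.QuantumComplexity.DerivativeWalsh (W fsum phi_eq_fsum fsum_eq_sum_mul_W
  fsum_eq_sum_mul_W' fsum_signOf_eq sqrt_two_pow_three_mul)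
open Summit.QuantumAdvantage.QuantumAdvantage.Theorems.CubicForrelation.NearExactIsExact
  (fc_isDegLeFun_comp rm_isDegLeFun_congr bb_deg_coord)
open Summit.QuantumAdvantage.QuantumAdvantage.Theorems.NearExactIsExact.Negative.ConcatDefect
  (cd_sum_signOf_mul_signOf)
open Summit.QuantumAdvantage.QuantumAdvantage.Theorems.NearExactIsExact.Negative.XorBound (xb_exists_order)
open Summit.QuantumAdvantage.QuantumAdvantage.Theorems.CubicForrelation.ExactPairsMaioranaMcFarland (dv_dual_dual)

variable {M k : ℕ}

/-! ### Blocks of `z ∈ 𝔽₂^{M + k}`: `z = (pre z ‖ suf z)` -/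

/-- The first `M` bits. -/
def pre (z : Fin (M + k) → Bool) : Fin M → Bool := fun i => z (Fin.castAdd k i)

/-- The last `k` bits. -/
def suf (z : Fin (M + k) → Bool) : Fin k → Bool := fun j => z (Fin.natAdd M j)

/-- `pre (u ‖ a) = u`. [folklore] -/
@[simp] theorem pre_append (u : Fin M → Bool) (a : Fin k → Bool) : pre (Fin.append u a) = u := by
  funext i; simp [pre]

/-- `suf (u ‖ a) = a`. [folklore] -/
@[simp] theorem suf_append (u : Fin M → Bool) (a : Fin k → Bool) : suf (Fin.append u a) = a := by
  funext j; simp [suf]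

/-- `(pre z ‖ suf z) = z`. [folklore] -/
theorem append_pre_suf (z : Fin (M + k) → Bool) : Fin.append (pre z) (suf z) = z :=
  Fin.append_castAdd_natAdd (f := z)

/-! ### The Walsh transform of a plain concatenation -/

/-- **`W_H(u ‖ s) = Σ_a (-1)^{s·a} W_{H(·‖a)}(u)`** for every Boolean `H` on `M + k` bits. [folklore] -/
theorem ts_W_append (H : (Fin (M + k) → Bool) → Bool) (u : Fin M → Bool) (s : Fin k → Bool) :
    W (fun y => signOf (H y)) (Fin.append u s) =
      ∑ a : Fin k → Bool, twist s a * W (fun v => signOf (H (Fin.append v a))) u := by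
  unfold W
  rw [sum_append, sum_comm]
  refine sum_congr rfl fun a _ => ?_
  rw [mul_sum]
  refine sum_congr rfl fun v _ => ?_
  rw [twist_append, twist_comm a s]
  ring

/-- **Row form.** If every slice has `W_{H(·‖a)} = K·(-1)^{D(·,a)}` then `W_H(u ‖ s) = K · W_{D(u,·)}(s)`:
the transform of the concatenation is the transform of the ROW `u` of the dual table. [folklore] -/
theorem ts_W_of_duals (H : (Fin (M + k) → Bool) → Bool) (D : (Fin M → Bool) → (Fin k → Bool) → Bool) (K : ℝ)
    (hH : ∀ a u, W (fun v => signOf (H (Fin.append v a))) u = K * signOf (D u a))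
    (u : Fin M → Bool) (s : Fin k → Bool) :
    W (fun y => signOf (H y)) (Fin.append u s) = K * W (fun a => signOf (D u a)) s := by
  rw [ts_W_append]
  simp_rw [hH]
  unfold W
  rw [mul_sum]
  refine sum_congr rfl fun a _ => ?_
  rw [twist_comm s a]
  ring

/-! ### The two-sided identity -/

/-- **`√(2^{3N})·Φ(E,H) = K_H K_E · Σ_{u,a} (-1)^{D_H(u,a)} (-1)^{D_E(u,a)}`** whenever the `a`-slices of `H` have
`W = K_H (-1)^{D_H(·,a)}` and the `u`-rows of `E` have `W = K_E (-1)^{D_E(u,·)}`. [folklore] -/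
theorem ts_fsum_eq (H E : (Fin (M + k) → Bool) → Bool) (DH DE : (Fin M → Bool) → (Fin k → Bool) → Bool)
    (KH KE : ℝ)
    (hH : ∀ a u, W (fun v => signOf (H (Fin.append v a))) u = KH * signOf (DH u a))
    (hE : ∀ u a, W (fun s => signOf (E (Fin.append u s))) a = KE * signOf (DE u a)) :
    Real.sqrt ((2 : ℝ) ^ (3 * (M + k))) * forrelation E H =
      KH * KE * ∑ u : Fin M → Bool, ∑ a : Fin k → Bool, signOf (DH u a) * signOf (DE u a) := by
  rw [← fsum_signOf_eq, fsum_eq_sum_mul_W, sum_append]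
  simp_rw [ts_W_of_duals H DH KH hH]
  have row : ∀ u : Fin M → Bool,
      ∑ s : Fin k → Bool, signOf (E (Fin.append u s)) * (KH * W (fun a => signOf (DH u a)) s) =
        KH * KE * ∑ a : Fin k → Bool, signOf (DH u a) * signOf (DE u a) := by
    intro u
    have e1 : ∑ s : Fin k → Bool, signOf (E (Fin.append u s)) * (KH * W (fun a => signOf (DH u a)) s) =
        KH * fsum (fun s => signOf (E (Fin.append u s))) (fun a => signOf (DH u a)) := by
      rw [fsum_eq_sum_mul_W, mul_sum]
      exact sum_congr rfl fun s _ => by ring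
    rw [e1, fsum_eq_sum_mul_W']
    simp_rw [hE u]
    rw [mul_assoc]
    congr 1
    rw [mul_sum]
    exact sum_congr rfl fun a _ => by ring
  simp_rw [row]
  rw [← mul_sum]

/-- `√(2^M)·√(2^k)·2^{M+k} = √(2^{3(M+k)})`. [folklore] -/
theorem ts_sqrt_mul (M k : ℕ) :
    Real.sqrt ((2 : ℝ) ^ M) * Real.sqrt ((2 : ℝ) ^ k) * (2 : ℝ) ^ (M + k) = Real.sqrt ((2 : ℝ) ^ (3 * (M + k))) := by
  rw [sqrt_two_pow_three_mul, ← Real.sqrt_mul (by positivity), ← pow_add]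
  ring

/-- Double sums of the appended table are sums over `𝔽₂^{M+k}`. [folklore] -/
theorem ts_sum_table (DH DE : (Fin M → Bool) → (Fin k → Bool) → Bool) :
    ∑ u : Fin M → Bool, ∑ a : Fin k → Bool, signOf (DH u a) * signOf (DE u a) =
      ∑ z : Fin (M + k) → Bool, signOf (DH (pre z) (suf z)) * signOf (DE (pre z) (suf z)) := by
  rw [sum_append]
  simp only [pre_append, suf_append]

/-- **THE TWO-SIDED IDENTITY.**  If every `a`-slice `v ↦ H(v ‖ a)` is bent with dual `D_H(·,a)` and every `u`-row
`s ↦ E(u ‖ s)` is bent with dual `D_E(u,·)`, then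
`Φ(E,H) = 1 − 2·#{z = (u ‖ a) : D_H(u,a) ≠ D_E(u,a)} / 2^{M+k}`. [folklore] -/
theorem ts_forrelation_eq (H E : (Fin (M + k) → Bool) → Bool) (DH DE : (Fin M → Bool) → (Fin k → Bool) → Bool)
    (hH : ∀ a u, W (fun v => signOf (H (Fin.append v a))) u = Real.sqrt ((2 : ℝ) ^ M) * signOf (DH u a))
    (hE : ∀ u a, W (fun s => signOf (E (Fin.append u s))) a = Real.sqrt ((2 : ℝ) ^ k) * signOf (DE u a)) :
    forrelation E H =
      1 - 2 * ((univ.filter fun z : Fin (M + k) → Bool => DH (pre z) (suf z) ≠ DE (pre z) (suf z)).card : ℝ) /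
        2 ^ (M + k) := by
  have key := ts_fsum_eq H E DH DE _ _ hH hE
  rw [ts_sum_table, cd_sum_signOf_mul_signOf, ← ts_sqrt_mul] at key
  have hM : (0 : ℝ) < Real.sqrt ((2 : ℝ) ^ M) := by positivity
  have hk : (0 : ℝ) < Real.sqrt ((2 : ℝ) ^ k) := by positivity
  have hN : (0 : ℝ) < (2 : ℝ) ^ (M + k) := by positivity
  have hprod : (0 : ℝ) < Real.sqrt ((2 : ℝ) ^ M) * Real.sqrt ((2 : ℝ) ^ k) := mul_pos hM hk
  have key' : (2 : ℝ) ^ (M + k) * forrelation E H =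
      (2 : ℝ) ^ (M + k) - 2 * ((univ.filter fun z : Fin (M + k) → Bool =>
        DH (pre z) (suf z) ≠ DE (pre z) (suf z)).card : ℝ) := by
    rw [mul_assoc] at key
    exact mul_left_cancel₀ hprod.ne' key
  field_simp
  linarith [key']

/-- **`Φ(E,H) = 1` iff the two dual tables coincide** (bent slices of `H`, bent rows of `E`). [folklore] -/
theorem ts_forrelation_eq_one_iff (H E : (Fin (M + k) → Bool) → Bool)
    (DH DE : (Fin M → Bool) → (Fin k → Bool) → Bool)
    (hH : ∀ a u, W (fun v => signOf (H (Fin.append v a))) u = Real.sqrt ((2 : ℝ) ^ M) * signOf (DH u a))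
    (hE : ∀ u a, W (fun s => signOf (E (Fin.append u s))) a = Real.sqrt ((2 : ℝ) ^ k) * signOf (DE u a)) :
    forrelation E H = 1 ↔ ∀ u a, DH u a = DE u a := by
  rw [ts_forrelation_eq H E DH DE hH hE]
  have hN : (0 : ℝ) < (2 : ℝ) ^ (M + k) := by positivity
  constructor
  · intro h
    have hc : ((univ.filter fun z : Fin (M + k) → Bool => DH (pre z) (suf z) ≠ DE (pre z) (suf z)).card : ℝ) = 0 := by
      have : 2 * ((univ.filter fun z : Fin (M + k) → Bool =>
          DH (pre z) (suf z) ≠ DE (pre z) (suf z)).card : ℝ) / 2 ^ (M + k) = 0 := by linarith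
      rcases div_eq_zero_iff.1 this with h0 | h0
      · linarith
      · exact absurd h0 hN.ne'
    have hc' : (univ.filter fun z : Fin (M + k) → Bool => DH (pre z) (suf z) ≠ DE (pre z) (suf z)).card = 0 := by
      exact_mod_cast hc
    intro u a
    by_contra hne
    have hmem : Fin.append u a ∈
        (univ.filter fun z : Fin (M + k) → Bool => DH (pre z) (suf z) ≠ DE (pre z) (suf z)) := by
      simp [hne]
    rw [card_eq_zero] at hc'
    simp [hc'] at hmem
  · intro h
    have hc : (univ.filter fun z : Fin (M + k) → Bool => DH (pre z) (suf z) ≠ DE (pre z) (suf z)).card = 0 := by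
      rw [card_eq_zero, filter_eq_empty_iff]
      intro z _ hne
      exact hne (h (pre z) (suf z))
    rw [hc]
    simp

/-! ### The symmetric case `M = k`: a single concatenation against its own block swap -/

/-- Exchange the two `k`-bit blocks: `swap (u ‖ s) = (s ‖ u)`. -/
def swap (z : Fin (k + k) → Bool) : Fin (k + k) → Bool := Fin.append (suf z) (pre z)

/-- `swap (u ‖ s) = (s ‖ u)`. [folklore] -/
@[simp] theorem swap_append (u s : Fin k → Bool) : swap (Fin.append u s) = Fin.append s u := by
  simp [swap]

/-- The block swap is a coordinate permutation, so it preserves algebraic degree. [folklore] -/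
theorem swap_isDegLeFun {d : ℕ} {H : (Fin (k + k) → Bool) → Bool} (hH : IsDegLeFun d H) :
    IsDegLeFun d (fun x => H (swap x)) := by
  refine fc_isDegLeFun_comp hH swap (fun v => ?_) (le_of_eq (one_mul d))
  induction v using Fin.addCases with
  | left j =>
    exact rm_isDegLeFun_congr (bb_deg_coord (Fin.natAdd k j)) fun x => by
      simp only [swap, Fin.append_left, suf]
  | right i =>
    exact rm_isDegLeFun_congr (bb_deg_coord (Fin.castAdd k i)) fun x => by
      simp only [swap, Fin.append_right, pre]

/-- **`Φ(H ∘ swap, H) = 1 − 2·#{(u,a) : D_H(u,a) ≠ D_H(a,u)} / 4^k`**: for a plain concatenation of `2^k` bent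
`k`-bit functions (duals `D_H(·,a)`), the block-swapped function is a partner whose rows are the slices of `H`, and
the pair is exact iff the dual table is SYMMETRIC. [folklore] -/
theorem ts_forrelation_swap (H : (Fin (k + k) → Bool) → Bool) (DH : (Fin k → Bool) → (Fin k → Bool) → Bool)
    (hH : ∀ a u, W (fun v => signOf (H (Fin.append v a))) u = Real.sqrt ((2 : ℝ) ^ k) * signOf (DH u a)) :
    forrelation (fun x => H (swap x)) H =
      1 - 2 * ((univ.filter fun z : Fin (k + k) → Bool => DH (pre z) (suf z) ≠ DH (suf z) (pre z)).card : ℝ) /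
        2 ^ (k + k) :=
  ts_forrelation_eq H (fun x => H (swap x)) DH (fun u a => DH a u) hH
    (fun u a => by simpa only [swap_append] using hH u a)

/-! ### Exact pairs of the habitat are the classical dual pairs -/

/-- `√(2^{κ+κ}) = 2^κ`. [folklore] -/
theorem ts_sqrt_two_pow_add_self (κ : ℕ) : Real.sqrt ((2 : ℝ) ^ (κ + κ)) = (2 : ℝ) ^ κ := by
  rw [pow_add, Real.sqrt_mul_self (by positivity)]

/-- **Exactness is classical.**  If the slices of `H` are bent (dual table `D_H`), the rows of `E` are bent (dual
table `D_E`) and the two tables COINCIDE, then `H` is bent with dual `E` (so `E = H̃` and the pair is the classical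
exact pair): `W_H(u‖s) = 2^{M/2} W_{D_H(u,·)}(s) = 2^{M/2} W_{D_E(u,·)}(s) = 2^{N/2} (-1)^{E(u‖s)}` by Fourier
inversion on the row (`dv_dual_dual`).  Hence a non-exact pair of the habitat is exactly one whose tables differ,
and near-exact NON-exact pairs require `H` (and `E`) NOT to be bent-with-that-dual. [folklore] -/
theorem ts_dual_of_tables_eq {m κ : ℕ} (H E : (Fin ((m + m) + (κ + κ)) → Bool) → Bool)
    (DH DE : (Fin (m + m) → Bool) → (Fin (κ + κ) → Bool) → Bool)
    (hH : ∀ a u, W (fun v => signOf (H (Fin.append v a))) u = Real.sqrt ((2 : ℝ) ^ (m + m)) * signOf (DH u a))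
    (hE : ∀ u a, W (fun s => signOf (E (Fin.append u s))) a = Real.sqrt ((2 : ℝ) ^ (κ + κ)) * signOf (DE u a))
    (heq : ∀ u a, DH u a = DE u a) (x : Fin ((m + m) + (κ + κ)) → Bool) :
    W (fun y => signOf (H y)) x = Real.sqrt ((2 : ℝ) ^ ((m + m) + (κ + κ))) * signOf (E x) := by
  rw [← append_pre_suf x, ts_W_of_duals H DH _ hH]
  have hrow : ∀ b, W (fun s' => signOf (E (Fin.append (pre x) s'))) b = (2 : ℝ) ^ κ * signOf (DE (pre x) b) :=
    fun b => by rw [hE, ts_sqrt_two_pow_add_self]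
  have hdd := dv_dual_dual κ (fun a => DE (pre x) a) (fun s' => E (Fin.append (pre x) s')) hrow (suf x)
  have htab : (fun a => signOf (DH (pre x) a)) = fun a => signOf (DE (pre x) a) :=
    funext fun a => by rw [heq]
  rw [htab, hdd, ← ts_sqrt_two_pow_add_self κ, ← mul_assoc, ← Real.sqrt_mul (by positivity), ← pow_add]

/-! ### Consequence for the crux: two-sided families with vanishing table distance -/

/-- **Lower bound from the table distance.** Under the hypotheses of `ts_forrelation_eq`, if at most `d` entries of
the two dual tables differ then `Φ(E,H) ≥ 1 − 2d/2^{M+k}`; if at least one differs then `Φ(E,H) < 1`. [folklore] -/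
theorem ts_forrelation_bounds (H E : (Fin (M + k) → Bool) → Bool) (DH DE : (Fin M → Bool) → (Fin k → Bool) → Bool)
    (hH : ∀ a u, W (fun v => signOf (H (Fin.append v a))) u = Real.sqrt ((2 : ℝ) ^ M) * signOf (DH u a))
    (hE : ∀ u a, W (fun s => signOf (E (Fin.append u s))) a = Real.sqrt ((2 : ℝ) ^ k) * signOf (DE u a))
    (d : ℕ) (hd : (univ.filter fun z : Fin (M + k) → Bool => DH (pre z) (suf z) ≠ DE (pre z) (suf z)).card ≤ d)
    (hne : ∃ u a, DH u a ≠ DE u a) :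
    1 - 2 * (d : ℝ) / 2 ^ (M + k) ≤ forrelation E H ∧ forrelation E H < 1 := by
  have hN : (0 : ℝ) < (2 : ℝ) ^ (M + k) := by positivity
  constructor
  · rw [ts_forrelation_eq H E DH DE hH hE]
    have hd' : ((univ.filter fun z : Fin (M + k) → Bool => DH (pre z) (suf z) ≠ DE (pre z) (suf z)).card : ℝ) ≤ d := by
      exact_mod_cast hd
    have := div_le_div_of_nonneg_right (mul_le_mul_of_nonneg_left hd' (by norm_num : (0 : ℝ) ≤ 2)) hN.le
    linarith
  · rcases lt_or_ge (forrelation E H) 1 with h | h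
    · exact h
    · exfalso
      obtain ⟨u, a, hua⟩ := hne
      have h1 : forrelation E H = 1 := le_antisymm (by
        rw [ts_forrelation_eq H E DH DE hH hE]
        have : (0 : ℝ) ≤ 2 * ((univ.filter fun z : Fin (M + k) → Bool =>
            DH (pre z) (suf z) ≠ DE (pre z) (suf z)).card : ℝ) / 2 ^ (M + k) := by positivity
        linarith) h
      exact hua ((ts_forrelation_eq_one_iff H E DH DE hH hE).1 h1 u a)

/-- **Two-sided families with vanishing relative table distance refute `NearExactIsExact`.**  HYPOTHESIS (OPEN — no
such family is known; the seat's census of the bi-Maiorana–McFarland sub-family found none): for every `j` there are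
an even split `M + k = (m+m) + (κ+κ)`, CUBIC `H, E` on `M + k` bits whose `a`-slices resp. `u`-rows are bent with
dual tables `D_H, D_E` differing in at most `2^{M+k}/2^j` entries, the pair NOT being the classical dual pair
(`H` is not bent-with-dual-`E`; by `ts_dual_of_tables_eq` this is the same as `D_H ≠ D_E`).  CONCLUSION: the cubic pairs
`(E, H)` have `1 − 2^{1−j} ≤ Φ < 1`, contradicting every threshold `θ < 1`.  An implication, not a refutation; it
records exactly what a two-sided (non-multiplicative, non-`pc`) disproof must supply. [this work] -/
theorem ts_nearExactIsExact_false_of_twoSidedFamilies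
    (Hfam : ∀ j : ℕ, ∃ m κ : ℕ,
      ∃ (H E : (Fin ((m + m) + (κ + κ)) → Bool) → Bool)
        (DH DE : (Fin (m + m) → Bool) → (Fin (κ + κ) → Bool) → Bool),
        IsDegLeFun 3 H ∧ IsDegLeFun 3 E ∧
        (∀ a u, W (fun v => signOf (H (Fin.append v a))) u = Real.sqrt ((2 : ℝ) ^ (m + m)) * signOf (DH u a)) ∧
        (∀ u a, W (fun s => signOf (E (Fin.append u s))) a = Real.sqrt ((2 : ℝ) ^ (κ + κ)) * signOf (DE u a)) ∧
        (∃ x, W (fun y => signOf (H y)) x ≠ Real.sqrt ((2 : ℝ) ^ ((m + m) + (κ + κ))) * signOf (E x)) ∧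
        (2 : ℝ) ^ j * ((univ.filter fun z : Fin ((m + m) + (κ + κ)) → Bool =>
            DH (pre z) (suf z) ≠ DE (pre z) (suf z)).card : ℝ) ≤ (2 : ℝ) ^ ((m + m) + (κ + κ))) :
    ¬ Summit.QuantumAdvantage.QuantumAdvantage.Theses.CubicForrelation.NearExactIsExact := by
  rintro ⟨θ, hθ, hiso⟩
  obtain ⟨j₀, hj₀⟩ := xb_exists_order θ hθ
  obtain ⟨m, κ, H, E, DH, DE, hHdeg, hEdeg, hH, hE, ⟨x₀, hx₀⟩, hsmall⟩ := Hfam j₀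
  have hne : ∃ u a, DH u a ≠ DE u a := by
    by_contra hall
    exact hx₀ (ts_dual_of_tables_eq H E DH DE hH hE (fun u a => not_ne_iff.mp fun h => hall ⟨u, a, h⟩) x₀)
  have hn : Even ((m + m) + (κ + κ)) := ⟨m + κ, by ring⟩
  set d := (univ.filter fun z : Fin ((m + m) + (κ + κ)) → Bool => DH (pre z) (suf z) ≠ DE (pre z) (suf z)).card
  obtain ⟨hge, hlt⟩ := ts_forrelation_bounds H E DH DE hH hE d le_rfl hne
  have hN : (0 : ℝ) < (2 : ℝ) ^ ((m + m) + (κ + κ)) := by positivity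
  have hj : (0 : ℝ) < (2 : ℝ) ^ j₀ := by positivity
  -- `2 d / 2^N ≤ 2 / 2^{j₀}`
  have hfrac : 2 * (d : ℝ) / 2 ^ ((m + m) + (κ + κ)) ≤ 2 / (2 : ℝ) ^ j₀ := by
    rw [div_le_div_iff₀ hN hj]
    nlinarith
  have hθΦ : θ < forrelation E H := by
    have := hj₀ j₀ le_rfl
    linarith
  have h1 := hiso ((m + m) + (κ + κ)) hn E H hEdeg hHdeg hθΦ
  linarith

/-- **Symmetric form.**  HYPOTHESIS (OPEN): for every `j` a CUBIC plain concatenation `H` of `2^{2κ}` bent `2κ`-bit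
functions (dual table `D_H`) whose table is NOT symmetric but has at most `2^{4κ}/2^j` asymmetric entries.
CONCLUSION: `¬ NearExactIsExact` (the pairs `(H ∘ swap, H)`).  An implication, not a refutation. [this work] -/
theorem ts_nearExactIsExact_false_of_nearSymmetricTables
    (Hsym : ∀ j : ℕ, ∃ κ : ℕ, ∃ (H : (Fin ((κ + κ) + (κ + κ)) → Bool) → Bool)
        (DH : (Fin (κ + κ) → Bool) → (Fin (κ + κ) → Bool) → Bool),
        IsDegLeFun 3 H ∧
        (∀ a u, W (fun v => signOf (H (Fin.append v a))) u = Real.sqrt ((2 : ℝ) ^ (κ + κ)) * signOf (DH u a)) ∧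
        (∃ u a, DH u a ≠ DH a u) ∧
        (2 : ℝ) ^ j * ((univ.filter fun z : Fin ((κ + κ) + (κ + κ)) → Bool =>
            DH (pre z) (suf z) ≠ DH (suf z) (pre z)).card : ℝ) ≤ (2 : ℝ) ^ ((κ + κ) + (κ + κ))) :
    ¬ Summit.QuantumAdvantage.QuantumAdvantage.Theses.CubicForrelation.NearExactIsExact := by
  rintro ⟨θ, hθ, hiso⟩
  obtain ⟨j₀, hj₀⟩ := xb_exists_order θ hθ
  obtain ⟨κ, H, DH, hdeg, hH, ⟨u₀, a₀, h₀⟩, hsmall⟩ := Hsym j₀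
  have hn : Even ((κ + κ) + (κ + κ)) := ⟨κ + κ, rfl⟩
  have hE : ∀ u a, W (fun s => signOf (H (swap (Fin.append u s)))) a =
      Real.sqrt ((2 : ℝ) ^ (κ + κ)) * signOf (DH a u) :=
    fun u a => by simpa only [swap_append] using hH u a
  set d := (univ.filter fun z : Fin ((κ + κ) + (κ + κ)) → Bool =>
    DH (pre z) (suf z) ≠ DH (suf z) (pre z)).card
  have hlt : forrelation (fun x => H (swap x)) H < 1 :=
    (ts_forrelation_bounds H (fun x => H (swap x)) DH (fun u a => DH a u) hH hE d le_rfl ⟨u₀, a₀, h₀⟩).2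
  have hN : (0 : ℝ) < (2 : ℝ) ^ ((κ + κ) + (κ + κ)) := by positivity
  have hj : (0 : ℝ) < (2 : ℝ) ^ j₀ := by positivity
  have hfrac : 2 * (d : ℝ) / 2 ^ ((κ + κ) + (κ + κ)) ≤ 2 / (2 : ℝ) ^ j₀ := by
    rw [div_le_div_iff₀ hN hj]
    nlinarith
  have hge : 1 - 2 / (2 : ℝ) ^ j₀ ≤ forrelation (fun x => H (swap x)) H := by
    rw [ts_forrelation_swap H DH hH]
    linarith
  have hθΦ : θ < forrelation (fun x => H (swap x)) H := lt_of_lt_of_le (hj₀ j₀ le_rfl) hge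
  have h1 := hiso ((κ + κ) + (κ + κ)) hn (fun x => H (swap x)) H (swap_isDegLeFun hdeg) hdeg hθΦ
  linarith

end Summit.QuantumAdvantage.QuantumAdvantage.Theorems.NearExactIsExact.Negative.TwoSidedConcat

end
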